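import Mathlib

/-!
# Manin–Gamma cell (pub-manin-gamma0): the cusp calculus of T1 §4 (Lemma 4.1, 4.2(a)(b)(c), 4.3), machine-checked (seat p1, gen 2)

These are the elementary congruence facts behind `proofs/T1_lead.md` §4 (evaluation of the Galois action on
the cusps of `X_{H′}` above the rational cusps `P_Q = 1/(N/Q)` of `X₀(N)`), stated over `ℤ` with `Int.ModEq`.
Throughout `N = Q * y` with `Q`, `y` coprime (`Q ∥ N`, `y = N/Q`).

* `delta_mul_inv`, `delta_mul_one`   — Lemma 4.1: `δ_Q · δ_{Q′} = δ_{QQ′}` (the CRT elements multiply).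
* `cusp_second_coord`, `cusp_first_coord` — Lemma 4.2(b): with `δ ≡ u⁻¹ (mod Q)`, `δ ≡ 1 (mod y)`,
  `a ≡ δ⁻¹ (mod N)` one has `(a + b y, δ y) ≡ (1 + j u′ y, u′ y) (mod N)` for some `j`
  — i.e. `⟨δ_Q(u)⟩[1;y] = [1;u′y] = τ_u[1;y]` by the `Γ₁(N)` cusp criterion (CM4).
* `level_cusp_unique` — Lemma 4.2(a): every cusp `a/c′` of level `gcd(c′,N) = y` is `Γ₀(N)`-equivalent to
  `1/y`: there are a unit `yt mod N` and `j` with `(yt a, c′) ≡ (1 + j y, yt y) (mod N)` (the `Γ₀(N)` criterion of CM4).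
* `level_of_mul_prime`, `level_of_div_prime` — Lemma 4.2(c): `τ ↦ pτ` preserves the level when `p ∤ N`.
* `truncation` — Lemma 4.3, consequence: if `u ≡ 1 (mod q^k)`, `k ≤ e`, then `δ_{q^e}(u) ≡ 1 (mod q^k · M)`.

Only Mathlib is imported. No `sorry`, no new axioms.
-/

namespace ManinGamma.CuspCalculus

/-! ### Lemma 4.1: multiplicativity of the CRT elements `δ_Q` -/

/-- Lemma 4.1 (inverse part): if `δ₁ ≡ u⁻¹ (mod Q₁)`, `δ₁ ≡ 1 (mod Q₂)`, `δ₂ ≡ u⁻¹ (mod Q₂)`, `δ₂ ≡ 1 (mod Q₁)`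
with `Q₁, Q₂` coprime, then `δ₁ δ₂ ≡ u⁻¹ (mod Q₁ Q₂)` (written multiplicatively: `δ₁ δ₂ u ≡ 1`). -/
theorem delta_mul_inv {Q₁ Q₂ δ₁ δ₂ u : ℤ} (hQ : IsCoprime Q₁ Q₂)
    (h1u : δ₁ * u ≡ 1 [ZMOD Q₁]) (h1' : δ₁ ≡ 1 [ZMOD Q₂])
    (h2u : δ₂ * u ≡ 1 [ZMOD Q₂]) (h2' : δ₂ ≡ 1 [ZMOD Q₁]) :
    δ₁ * δ₂ * u ≡ 1 [ZMOD Q₁ * Q₂] := by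
  have hA : δ₁ * δ₂ * u ≡ 1 [ZMOD Q₁] := by
    have := h2'.mul h1u
    simpa [mul_comm, mul_left_comm, mul_assoc] using this
  have hB : δ₁ * δ₂ * u ≡ 1 [ZMOD Q₂] := by
    have := h1'.mul h2u
    simpa [mul_comm, mul_left_comm, mul_assoc] using this
  rw [Int.modEq_iff_dvd] at hA hB ⊢
  exact hQ.mul_dvd hA hB

/-- Lemma 4.1 (unit part): `δ₁ ≡ 1`, `δ₂ ≡ 1 (mod M)` give `δ₁ δ₂ ≡ 1 (mod M)`. -/
theorem delta_mul_one {M δ₁ δ₂ : ℤ} (h1 : δ₁ ≡ 1 [ZMOD M]) (h2 : δ₂ ≡ 1 [ZMOD M]) :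
    δ₁ * δ₂ ≡ 1 [ZMOD M] := by
  simpa using h1.mul h2

/-! ### Lemma 4.2(b): `⟨δ_Q(u)⟩ [1;y] = [1;u′y]` via the `Γ₁(N)` cusp criterion -/

/-- Lemma 4.2(b), second coordinate: `δ ≡ u′ (mod Q)` implies `δ y ≡ u′ y (mod Q y)`. -/
theorem cusp_second_coord {Q y δ u' : ℤ} (h : δ ≡ u' [ZMOD Q]) : δ * y ≡ u' * y [ZMOD Q * y] :=
  h.mul_right'

/-- Lemma 4.2(b), first coordinate: if `a ≡ 1 (mod y)` and `u u′ ≡ 1 (mod Q)` then for every `b` there is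
`j` with `a + b y ≡ 1 + j u′ y (mod Q y)`.  (In the text: `a ≡ δ⁻¹ ≡ 1 (mod y)`; take `j ≡ (k + b) u (mod Q)`
where `a − 1 = k y`; below `k` carries the opposite sign.) -/
theorem cusp_first_coord {Q y a b u u' : ℤ} (ha : a ≡ 1 [ZMOD y]) (hu : u * u' ≡ 1 [ZMOD Q]) :
    ∃ j : ℤ, a + b * y ≡ 1 + j * u' * y [ZMOD Q * y] := by
  -- `a ≡ 1 (mod y)` : `y ∣ 1 - a`
  obtain ⟨k, hk⟩ := (Int.modEq_iff_dvd.mp ha)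
  -- `u u' ≡ 1 (mod Q)` : `Q ∣ 1 - u u'`
  obtain ⟨r, hr⟩ := (Int.modEq_iff_dvd.mp hu)
  refine ⟨(b - k) * u, ?_⟩
  rw [Int.modEq_iff_dvd]
  -- 1 + (b-k) u u' y - (a + b y) = (b-k) y (u u') + y k - b y = -(b-k) y Q r   (a = 1 - y k, u u' = 1 - Q r)
  refine ⟨-(r * (b - k)), ?_⟩
  have hk' : a = 1 - y * k := by linarith
  have hr' : u * u' = 1 - Q * r := by linarith
  subst hk'
  calc 1 + (b - k) * u * u' * y - (1 - y * k + b * y)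
      = (b - k) * y * (u * u') + y * k - b * y := by ring
    _ = (b - k) * y * (1 - Q * r) + y * k - b * y := by rw [hr']
    _ = Q * y * -(r * (b - k)) := by ring

/-- Lemma 4.2(b), both coordinates together, in the exact shape of the `Γ₁(N)` criterion (CM4):
hypotheses `N = Q y`, `δ u ≡ 1 (mod Q)` (i.e. `δ ≡ u⁻¹`), `δ ≡ 1 (mod y)`, `a δ ≡ 1 (mod N)` (so `γ_δ = (a b; N c′ d)`
with `d ≡ δ`), `u u′ ≡ 1 (mod N)`. Conclusion: the primitive vector `(a + b y, δ y) = γ_δ · (1, y)ᵗ (mod N)` is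
`≡ (1 + j u′ y, u′ y)`, i.e. represents the cusp `[1; u′ y]` of `X₁(N)`. -/
theorem cusp_action {Q y a b δ u u' : ℤ}
    (hδu : δ * u ≡ 1 [ZMOD Q]) (hδ1 : δ ≡ 1 [ZMOD y]) (haδ : a * δ ≡ 1 [ZMOD Q * y])
    (huu' : u * u' ≡ 1 [ZMOD Q * y]) :
    ∃ j : ℤ, a + b * y ≡ 1 + j * u' * y [ZMOD Q * y] ∧ δ * y ≡ u' * y [ZMOD Q * y] := by
  -- δ ≡ u' (mod Q): both are inverses of u mod Q
  have huu'Q : u * u' ≡ 1 [ZMOD Q] := huu'.of_mul_right y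
  have hδu' : δ ≡ u' [ZMOD Q] := by
    -- δ = δ·1 ≡ δ (u u') = (δ u) u' ≡ u'
    have h1 : δ * (u * u') ≡ δ * 1 [ZMOD Q] := huu'Q.mul_left δ
    have h2 : δ * u * u' ≡ 1 * u' [ZMOD Q] := hδu.mul_right u'
    have h3 : δ * (u * u') = δ * u * u' := by ring
    rw [h3] at h1
    simpa using (h1.symm.trans h2)
  -- a ≡ 1 (mod y): a δ ≡ 1 (mod y) and δ ≡ 1 (mod y)
  have ha1 : a ≡ 1 [ZMOD y] := by
    have h1 : a * δ ≡ 1 [ZMOD y] := haδ.of_mul_left Q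
    have h2 : a * δ ≡ a * 1 [ZMOD y] := hδ1.mul_left a
    simpa using h2.symm.trans h1
  obtain ⟨j, hj⟩ := cusp_first_coord (b := b) ha1 huu'Q
  exact ⟨j, hj, cusp_second_coord hδu'⟩

/-! ### Lemma 4.2(a): the cusp of level `y = N/Q` is unique -/

/-- Lemma 4.2(a) (uniqueness of the level-`y` cusp, `Q ∥ N`, `N = Q y`): let `a/c′` be in lowest terms with
`c′ = y c₁`, `gcd(c₁, Q) = 1` (equivalently `gcd(c′, N) = y`). Then there are `yt` coprime to `N` and `j` with
`(yt a, c′) ≡ (1 + j y, yt y) (mod N)` — the `Γ₀(N)` cusp criterion (CM4) for `a/c′ ∼ 1/y`. -/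
theorem level_cusp_unique {Q y a c' c₁ : ℤ} (hQy : IsCoprime Q y) (hc : c' = y * c₁)
    (hc₁ : IsCoprime c₁ Q) (hac : IsCoprime a c') :
    ∃ yt j : ℤ, IsCoprime yt (Q * y) ∧ yt * a ≡ 1 + j * y [ZMOD Q * y] ∧ c' ≡ yt * y [ZMOD Q * y] := by
  -- Bezout data
  obtain ⟨s, t, hst⟩ := hQy            -- s Q + t y = 1
  have hay : IsCoprime a y := by
    rw [hc] at hac; exact hac.of_mul_right_left
  obtain ⟨m, n, hmn⟩ := hay            -- m a + n y = 1
  -- CRT element: yt ≡ c₁ (mod Q), yt ≡ m (mod y)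
  set yt : ℤ := c₁ * (t * y) + m * (s * Q) with hyt
  have hytQ : yt = c₁ + Q * (s * (m - c₁)) := by
    have : t * y = 1 - s * Q := by linarith
    rw [hyt, this]; ring
  have hyty : yt = m + y * (t * (c₁ - m)) := by
    have : s * Q = 1 - t * y := by linarith
    rw [hyt, this]; ring
  -- yt a - 1 is divisible by y
  have hdiv : y ∣ yt * a - 1 := by
    refine ⟨t * (c₁ - m) * a - n, ?_⟩
    rw [hyty]
    have : m * a = 1 - n * y := by linarith
    calc (m + y * (t * (c₁ - m))) * a - 1 = m * a + y * (t * (c₁ - m)) * a - 1 := by ring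
      _ = (1 - n * y) + y * (t * (c₁ - m)) * a - 1 := by rw [this]
      _ = y * (t * (c₁ - m) * a - n) := by ring
  obtain ⟨j, hj⟩ := hdiv
  refine ⟨yt, j, ?_, ?_, ?_⟩
  · -- coprime to Q and to y
    apply IsCoprime.mul_right
    · rw [hytQ]; exact hc₁.add_mul_left_left _
    · rw [hyty]
      have hmy : IsCoprime m y := ⟨a, n, by linarith⟩
      exact hmy.add_mul_left_left _
  · -- yt a = 1 + j y exactly
    have : yt * a = 1 + j * y := by linarith
    rw [this]
  · -- c' - yt y = y (c₁ - yt) and Q ∣ c₁ - yt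
    rw [Int.modEq_iff_dvd, hc, hytQ]
    exact ⟨s * (m - c₁), by ring⟩

/-! ### Lemma 4.2(c): the Hecke correspondence `T_p` (p ∤ N) preserves the level of a cusp -/

/-- If `p ∤ c′` then `p a / c′` is still in lowest terms (and has the same denominator, hence the same level). -/
theorem level_of_mul_prime {p a c' : ℕ} (hp : p.Prime) (hac : Nat.Coprime a c') (hpc : ¬ p ∣ c') :
    Nat.Coprime (p * a) c' :=
  Nat.Coprime.mul_left ((Nat.Prime.coprime_iff_not_dvd hp).mpr hpc) hac

/-- If `p ∣ c′`, `c′ = p c″`, and `p ∤ N`, then `gcd(c″, N) = gcd(c′, N)`: the level is unchanged. -/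
theorem level_of_div_prime {p c'' N : ℕ} (hpN : Nat.Coprime p N) :
    Nat.gcd (p * c'') N = Nat.gcd c'' N :=
  Nat.Coprime.gcd_mul_left_cancel c'' hpN

/-! ### Lemma 4.3 (consequence): `χ′ ∘ δ_Q` factors through `u mod q^{⌈e/2⌉}` -/

/-- Lemma 4.3, consequence used in Prop. 4.6(i)(ii): let `Q = q^e`, `k ≤ e`, `δ u ≡ 1 (mod q^e)` (`δ ≡ u⁻¹ mod Q`),
`δ ≡ 1 (mod M)` (`M` = the prime-to-`q` part of `N/t`, coprime to `q^k`). If `u ≡ 1 (mod q^k)` then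
`δ ≡ 1 (mod q^k M)`, i.e. `δ ∈ {d ≡ 1 mod N/t} ⊆ H′`. -/
theorem truncation {q M δ u : ℤ} {k e : ℕ} (hk : k ≤ e)
    (hδu : δ * u ≡ 1 [ZMOD q ^ e]) (hu : u ≡ 1 [ZMOD q ^ k]) (hδM : δ ≡ 1 [ZMOD M])
    (hcop : IsCoprime (q ^ k) M) : δ ≡ 1 [ZMOD q ^ k * M] := by
  have hδuk : δ * u ≡ 1 [ZMOD q ^ k] := hδu.of_dvd (pow_dvd_pow q hk)
  have hδk : δ ≡ 1 [ZMOD q ^ k] := by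
    have h1 : δ * u ≡ δ * 1 [ZMOD q ^ k] := hu.mul_left δ
    simpa using h1.symm.trans hδuk
  rw [Int.modEq_iff_dvd] at hδk hδM ⊢
  exact hcop.mul_dvd hδk hδM

/-! ### Lemma 4.1: `δ_N(u) = u⁻¹`, `δ_1(u) = 1` are the trivial cases; and `δ_Q(u)` depends only on `u mod Q` -/

/-- `δ_Q(u)` depends only on `u mod Q`: two elements that are `≡ 1 (mod y)` and inverse to the same `u (mod Q)`
are congruent mod `N = Q y`. (Uniqueness of the CRT element.) -/
theorem delta_unique {Q y δ δ' u : ℤ} (hQy : IsCoprime Q y)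
    (h1 : δ * u ≡ 1 [ZMOD Q]) (h1' : δ' * u ≡ 1 [ZMOD Q]) (h2 : δ ≡ 1 [ZMOD y]) (h2' : δ' ≡ 1 [ZMOD y]) :
    δ ≡ δ' [ZMOD Q * y] := by
  -- mod Q: δ = δ (δ' u) ≡ ... use δ ≡ δ δ' u ≡ δ' (commutativity)
  have hQ : δ ≡ δ' [ZMOD Q] := by
    have e1 : δ * (δ' * u) ≡ δ * 1 [ZMOD Q] := h1'.mul_left δ
    have e2 : δ' * (δ * u) ≡ δ' * 1 [ZMOD Q] := h1.mul_left δ'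
    have e3 : δ * (δ' * u) = δ' * (δ * u) := by ring
    rw [e3] at e1
    simpa using e1.symm.trans e2
  have hy : δ ≡ δ' [ZMOD y] := h2.trans h2'.symm
  rw [Int.modEq_iff_dvd] at hQ hy ⊢
  exact hQy.mul_dvd hQ hy

end ManinGamma.CuspCalculus
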